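import Literature.MathematicalPhysics.QuantumFieldTheory.Balaban1983to89.B9Thm313WholeBlocksNbr
import Literature.MathematicalPhysics.QuantumFieldTheory.Balaban1983to89.B9Thm312WholeBlocksNbrRec

/-!
# `Balaban1983to89.B9Thm313WholeBlocksNbrRec` — [B9] Theorem 3.13 (p. 426): the L² BLOCK (3.46) of a kernel family co-read on the metric
# neighbourhood of y by the models of 𝔊 = 𝔓G₁, INDEXED IN THE RECORD ORDER (n = 3 ↦ the MIXED member ∇_U𝔊∇\*_U, n = 4 ↦ the pair family
# ∇_ν∇_μ𝔊, n = 5 ↦ the pair family 𝔊∇\*_ν∇\*_μ), and the reading-free six block bounds of 𝔊 behind both orders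

T. Bałaban, *Propagators for lattice gauge theories in a background field*, Commun. Math. Phys. **99** (1985) 389–434
[`Balaban1985BackgroundPropagators`, "B9"]; [4] = T. Bałaban, *Propagators and renormalization transformations for lattice
gauge theories. II*, Commun. Math. Phys. **96** (1984) 223–250 [`Balaban1984PropagatorsII`].

statement-level skeleton of published theorems with citation tags; proofs where landed; nothing here is a claim about the
Yang–Mills mass gap

THE PRINTED LOCI are those of `…B9Thm313WholeBlocksNbr` (verbatim there).  INDEX MAP (referee ref-A's located point IDX34, 2026-08-27): PRINT
(3.46) p. 398: n = 3 ∇_U∇_UG′, 4 ∇_UG′∇\*_U, 5 G′∇\*_U∇\*_U; the RECORD's `Node00.kernelFamilyB.l2`: n = 3 ∇_νO∇\*_μ (mixed), 4 ∇_ν∇_μO, 5 O∇\*_ν∇\*_μ.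
`…BlocksNbr.GG_l2Block_nbr` binds the print order; THIS FILE binds the record order (as n06-k's `B9RWSumsDefinitePinsPair`), through the
reading-free six bounds and `B9Thm312WholeBlocksNbrRec.l2Block_of_blockBds_nbrRec`.

* `GG_blockBds_nbr` — the six block-L² bounds of 𝔊 at (K₆, δ), READING-FREE (the body of `GG_l2Block_nbr` before its last line).
* ★ `GG_l2Block_nbrRec` — the record-order twin of `GG_l2Block_nbr`.

HONEST SCOPE.  Index routing and kernel bookkeeping only; nothing of [B9] or [4] is asserted; every schema, letter and reading is a HYPOTHESIS of
printed ∕ definitional shape.  NOT a node discharge, NOT summit progress; count-neutral; one finite lattice at a time; nothing continuum, nothing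
about the mass gap.  Cell `pub-ymgap` (HUMAN RULING D-0062), Track A node N06 [B9], N06-ASSIGNMENT v1 row 21 (bundle F7), seat
`pub-ymgap-dag-n06-l` (g5), 2026-08-27.
-/

namespace Literature.MathematicalPhysics.QuantumFieldTheory.Balaban1983to89.B9Thm313WholeBlocksNbrRec

open Literature.MathematicalPhysics.QuantumFieldTheory.Balaban1983to89
open Finset B6RandomWalk B6RandomWalkHom B9Thm34Ext B9Thm37GlueCor36 B11SectG B9SectDSup
open B9Thm37AllNorms B9Thm37AllNormsInstances B9FromB6 B9SectBStepWhole B9Thm312Whole B9Thm312WholeLeaf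
open B9Thm312WholeLeft B9Thm313Whole B9Thm313WholeLeft
open B9Thm37Glue B9SectDL2Decay B9RWSums343Holder B9RWSumsReadsRel B9RWSumsReadsNbr B9Ineq347 B9Thm312WholeClasses B9Thm312WholeL2
open B9Thm312WholeBlocksRel B9Thm312WholeBlocksNbr B9Thm312WholeHolder B9Thm312WholeHHolder B9Thm313WholeHolder B9Thm313WholeL2G
open B9Thm313WholeL2GP B9Thm313WholeInput B9RWSums346SecondDiff B9Thm313WholeBlocksNbr B9Thm312WholeBlocksNbrRec

noncomputable section

section OneMember

variable {g : B9.Geometry} {B : B9.Backgrounds} {X Y Z W P : Type}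
variable [Fintype X] [Fintype Y] [Fintype Z] [Fintype W] [Fintype P] [Fintype g.Site] [DecidableEq g.Site]
variable {R₀ : ℝ} {H₀ : Prop}

omit [DecidableEq g.Site] in
/-- ★ **THEOREM 3.13 — THE SIX BLOCK-L² BOUNDS (3.46) OF 𝔊 = 𝔓G₁ AT ONE MEMBER AND ONE CONFIGURATION, READING-FREE** (the operator-level
content of `…B9Thm313WholeBlocksNbr.GG_l2Block_nbr` before any co-reading, so that the member lines can be read in EITHER index order).  Data at U: Theorem 3.3 for G₀ (sup entries `he0 he2`, the derivative of the step `hLS`, the pair-indexed L² schema `hL2`), the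
step on 𝔠⁽¹⁾, 𝔠⁽²⁾ (`hS1 hS2`) and in the L² class (`hT`), the letters of (3.152)–(3.153) (`hL hLD hLt`), the identities (`hI`), 𝔊 symmetric and
(∇_U𝔊)ᵀ = 𝔊∇\*_U, [4] Lemma 2.1 (row sum at σ; transfers at γ = 1, ½, −1 with constants below Λ_u ≧ 1), the co-readings `L2ReadsNbr` of `K.l2 0…5` by
… are NOT needed here: the conclusion is the conjunction of the six block bounds of 𝔊, ∇_U𝔊, 𝔊∇\*_U, `familyOp (q ↦ ∇_{q.1}∇_{q.2}∘𝔊)`, ∇_U𝔊∇\*_U,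
`familyOp (q ↦ 𝔊∘∇\*_{q.1}∇\*_{q.2})` at K₆·pref6(Lʲη)ₙ (printed weights) and the rate δ; the member constants are dominated by explicit binders: C_sup
above `const313 …` and `constD313 …` (lines 0–2), K_G above `constG46 (constKp B₂ B₄ θ₂′ c) c` (lines 3–5), and K₆ above C_sup·Λ_u, K_G,
√|P×P|·K_G·Λ_u.  Provisos: ρ′ + 3σ ≦ ρ, ρ′ + 5σ ≦ ρ ≦ δ₀, δ₃; ρ + σ ≦ δ_K; θc < 1; B₂θ₂′c² < 1; δ ≦ (1 − α)ρ′, δ ≦ ρ′.  Nothing of print asserted.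
[cite: Balaban1985BackgroundPropagators, Thm 3.13 p.426 + (3.152)–(3.153) p.426 + (3.46) p.398 + (3.39) p.397 + (3.42) p.397 + Thm 3.12 p.423 + p.391; Balaban1984PropagatorsII, (2.51)–(2.52) p.232 + Lemma 2.1 (2.60)–(2.61) p.234] -/
theorem GG_blockBds_nbr (hG : GeoOK g) {𝔬 : Ops g B X Y Z W}
    {Dd Dds : B.Cfg → P → Module.End ℝ (X → ℝ)} {U : B.Cfg} {bH : BlockNorm (toB6 g R₀ H₀) (W → ℝ)}
    {θ θ' θ₂' B₀ B₂ B₃ B₄ δ₀ δ₃ δK ρ ρ' α σ c Csup KGu K6 Λ₁ Λh Λm Λu δ : ℝ}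
    (hrow : RowSum (toB6 g R₀ H₀) σ c) (hc : 0 ≤ c) (hθ : 0 ≤ θ) (hθ' : 0 ≤ θ') (hθ₂' : 0 ≤ θ₂') (hB₀ : 0 ≤ B₀) (hB₂ : 0 ≤ B₂)
    (hB₃ : 0 ≤ B₃) (hB₄ : 0 ≤ B₄) (hσ : 0 ≤ σ) (hρ' : 0 < ρ') (hρ'ρ : ρ' + 3 * σ ≤ ρ) (hρ'ρ₅ : ρ' + 5 * σ ≤ ρ) (hρS : ρ ≤ δ₀)
    (hρ₃ : ρ ≤ δ₃) (hρδ : ρ + σ ≤ δK) (hq1 : θ * c < 1) (hq₂1 : B₂ * θ₂' * c * c < 1) (hδ1 : δ ≤ (1 - α) * ρ') (hδ2 : δ ≤ ρ')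
    (hST1 : ScaleTransfer g ρ' α Λ₁ (fun y => g.len y ^ (1 : ℝ))) (hSTh : ScaleTransfer g ρ' α Λh (fun y => g.len y ^ (1 / 2 : ℝ)))
    (hSTm : ScaleTransfer g ρ' α Λm (fun y => g.len y ^ (-1 : ℝ))) (hΛ₁0 : 0 ≤ Λ₁) (hΛ₁le : Λ₁ ≤ Λu) (hΛhle : Λh ≤ Λu)
    (hΛm0 : 0 ≤ Λm) (hΛmle : Λm ≤ Λu) (h1Λu : 1 ≤ Λu)
    (hCsup0 : 0 ≤ Csup) (hCle : const313 (B₀ * (1 - θ * c)⁻¹) (B₃ * (1 - θ * c)⁻¹) B₃ c ≤ Csup)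
    (hDle : constD313 (B₀ + θ' * (B₀ * (1 - θ * c)⁻¹) * c) θ' (B₀ * (1 - θ * c)⁻¹) (B₃ * (1 - θ * c)⁻¹) B₃ bH.κ c ≤ Csup)
    (hKGu0 : 0 ≤ KGu) (hKGle : constG46 (constKp B₂ B₄ θ₂' c) c ≤ KGu) (hK60 : 0 ≤ K6) (hK6a : Csup * Λu ≤ K6) (hK6b : KGu ≤ K6)
    (hK6c : Real.sqrt (Fintype.card (P × P)) * (KGu * Λu) ≤ K6)
    (hS1 : HasMaj (cNorm R₀ H₀ 𝔬.blk hG.lenle 1) (cNorm R₀ H₀ 𝔬.blk hG.lenle 1) (𝔬.G0 U ∘ₗ (𝔬.Tpi U + 𝔬.T2 U))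
      (fun a b => θ * Real.exp (-(δK * g.dist a b))))
    (hS2 : HasMaj (cNorm R₀ H₀ 𝔬.blk hG.lenle 2) (cNorm R₀ H₀ 𝔬.blk hG.lenle 2) (𝔬.G0 U ∘ₗ (𝔬.Tpi U + 𝔬.T2 U))
      (fun a b => θ * Real.exp (-(δK * g.dist a b))))
    (he0 : HasMajorant (g := toB6 g R₀ H₀) 𝔬.blk (𝔬.G0 U) (fun a b => B₀ * g.len a ^ 2 * Real.exp (-(δ₀ * g.dist a b))))
    (he2 : HasMajorantHom (g := toB6 g R₀ H₀) 𝔬.blkY 𝔬.blk (𝔬.G0 U ∘ₗ 𝔬.Dstar U)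
      (fun a b => B₀ * g.len a * Real.exp (-(δ₀ * g.dist a b))))
    (hLS : LeftStep 𝔬 R₀ H₀ hG.lenle B₀ δ₀ θ' δK U)
    (hL : Letters313 𝔬 R₀ H₀ hG B₃ δ₃ U) (hLD : Letters313D 𝔬 R₀ H₀ hG B₃ δ₃ bH U) (hI : Identities 𝔬 U)
    (hL2 : Thm33G0L2P 𝔬 Dd Dds R₀ H₀ B₂ ρ U)
    (hT : BlockBd (g := toB6 g R₀ H₀) 𝔬.blk 𝔬.blk (𝔬.Tpi U + 𝔬.T2 U)
      (fun (y y' : g.Site) => θ₂' * (g.len y)⁻¹ * (g.len y')⁻¹ * Real.exp (-(ρ * g.dist y y'))))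
    (hLt : Letters313L2P 𝔬 Dd Dds R₀ H₀ B₄ ρ U)
    (hsym : IsTransposePair (𝔬.GG U) (𝔬.GG U)) (htr : IsTransposePair (𝔬.D U ∘ₗ 𝔬.GG U) (𝔬.GG U ∘ₗ 𝔬.Dstar U)) :
    BlockBd (g := toB6 g R₀ H₀) 𝔬.blk 𝔬.blk (𝔬.GG U)
        (fun (y y' : g.Site) => K6 * B9.pref6 (g.len y) 0 * Real.exp (-(δ * g.dist y y'))) ∧
      BlockBd (g := toB6 g R₀ H₀) 𝔬.blk 𝔬.blkY (𝔬.D U ∘ₗ 𝔬.GG U)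
        (fun (y y' : g.Site) => K6 * B9.pref6 (g.len y) 1 * Real.exp (-(δ * g.dist y y'))) ∧
      BlockBd (g := toB6 g R₀ H₀) 𝔬.blkY 𝔬.blk (𝔬.GG U ∘ₗ 𝔬.Dstar U)
        (fun (y y' : g.Site) => K6 * B9.pref6 (g.len y) 2 * Real.exp (-(δ * g.dist y y'))) ∧
      BlockBd (g := toB6 g R₀ H₀) 𝔬.blk (𝔬.blk ∘ Prod.fst) (familyOp (fun q : P × P => (Dd U q.1 ∘ₗ Dd U q.2) ∘ₗ 𝔬.GG U))
        (fun (y y' : g.Site) => K6 * B9.pref6 (g.len y) 3 * Real.exp (-(δ * g.dist y y'))) ∧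
      BlockBd (g := toB6 g R₀ H₀) 𝔬.blkY 𝔬.blkY (𝔬.D U ∘ₗ (𝔬.GG U ∘ₗ 𝔬.Dstar U))
        (fun (y y' : g.Site) => K6 * B9.pref6 (g.len y) 4 * Real.exp (-(δ * g.dist y y'))) ∧
      BlockBd (g := toB6 g R₀ H₀) 𝔬.blk (𝔬.blk ∘ Prod.fst) (familyOp (fun q : P × P => 𝔬.GG U ∘ₗ (Dds U q.1 ∘ₗ Dds U q.2)))
        (fun (y y' : g.Site) => K6 * B9.pref6 (g.len y) 5 * Real.exp (-(δ * g.dist y y'))) := by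
  -- the body of `B9Thm313WholeBlocksNbr.GG_l2Block_nbr` up to the reading step
  set NP : ℝ := Real.sqrt (Fintype.card (P × P)) with hNP
  have hNP0 : 0 ≤ NP := Real.sqrt_nonneg _
  have hq : θ * c ≤ 1 := hq1.le
  have hinv0 : 0 ≤ (1 - θ * c)⁻¹ := inv_nonneg.mpr (by linarith)
  have hA₁ : 0 ≤ B₀ * (1 - θ * c)⁻¹ := mul_nonneg hB₀ hinv0
  have hA₃ : 0 ≤ B₃ * (1 - θ * c)⁻¹ := mul_nonneg hB₃ hinv0
  have hC0 : 0 ≤ const313 (B₀ * (1 - θ * c)⁻¹) (B₃ * (1 - θ * c)⁻¹) B₃ c := const313_nonneg hA₁ hA₃ hB₃ hc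
  have hlen := hG.lenle
  have hΛu0 : 0 ≤ Λu := zero_le_one.trans h1Λu
  -- the model majorants of 𝔊 at the rate ρ′ (sup entries of (3.153), proved upstream)
  have hm0 := GG_entry0_of_letters hG hrow hc hθ hB₀ hB₃ hσ hρ'.le hρ'ρ hρS hρ₃ hρδ hq1 hS2 he0 hL hI
  have hm1 := GG_entry1_of_letters hG hrow hc hθ hθ' hB₀ hB₃ hσ hρ'.le hρ'ρ hρS hρ₃ hρδ hq1 hS2 he0 hLS hL hLD hI
  have hm2 := GG_entry2_of_letters hG hrow hc hθ hB₀ hB₃ hσ hρ'.le hρ'ρ hρS hρ₃ hρδ hq1 hS1 he2 hL hI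
  -- lines 0, 1, 2 by the Schur test and the scale transfer
  have hb0 := l2bd_entry0_of_sup (R₀ := R₀) (H₀ := H₀) hG hC0 hST1 hm0 hsym
  have hm1' : HasMajorantHom (g := toB6 g R₀ H₀) 𝔬.blk 𝔬.blkY (𝔬.D U ∘ₗ 𝔬.GG U)
      (fun (a b : g.Site) => Csup * g.len a * Real.exp (-(ρ' * g.dist a b))) :=
    hasMajorantHom_mono (g := toB6 g R₀ H₀) 𝔬.blk 𝔬.blkY hm1 fun a b =>
      mul_le_mul_of_nonneg_right (mul_le_mul_of_nonneg_right hDle (hlen a)) (Real.exp_nonneg _)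
  have hm2' : HasMajorantHom (g := toB6 g R₀ H₀) 𝔬.blkY 𝔬.blk (𝔬.GG U ∘ₗ 𝔬.Dstar U)
      (fun (a b : g.Site) => Csup * g.len a * Real.exp (-(ρ' * g.dist a b))) :=
    hasMajorantHom_mono (g := toB6 g R₀ H₀) 𝔬.blkY 𝔬.blk hm2 fun a b =>
      mul_le_mul_of_nonneg_right (mul_le_mul_of_nonneg_right hCle (hlen a)) (Real.exp_nonneg _)
  obtain ⟨hb1, hb2⟩ := l2bd_entry12_of_sup (R₀ := R₀) (H₀ := H₀) hG hCsup0 hSTh hm1' hm2' htr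
  -- lines 3, 4, 5 from the pair schemas (line 4 through the Laplacian-free projections)
  have hb4 := GG_l2bd_entry4 hG hrow hB₂ hB₄ hθ₂' hρ'.le hσ hρ'ρ₅ (Thm33G0L2P.toLap hB₂ hG.lenle hL2) hT
    (Letters313L2P.toLap hB₄ hG.lenle hLt) hI hq₂1
  have hb3 := GG_l2bd_family3 hG hrow hB₂ hB₄ hθ₂' hρ'.le hσ hρ'ρ₅ hΛ₁0 hST1 hL2 hT hLt hI hq₂1
  have hb5 := GG_l2bd_family5 hG hrow hB₂ hB₄ hθ₂' hρ'.le hσ hρ'ρ₅ hΛm0 hSTm hL2 hT hLt hI hq₂1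
  have hρα : ρ' - α * ρ' = (1 - α) * ρ' := by ring
  rw [hρα] at hb3 hb5
  -- the member constants below K₆ and the rates above δ
  have hS0 : 0 ≤ B₂ + B₄ := add_nonneg hB₂ hB₄
  have hKp0 : 0 ≤ constKp B₂ B₄ θ₂' c := (constP_nonneg_le hθ₂' hc hq₂1 hS0 hS0 hS0 le_rfl le_rfl le_rfl).1
  have hKG0 : 0 ≤ constG46 (constKp B₂ B₄ θ₂' c) c := constG46_nonneg hKp0 hc
  have hK0le : const313 (B₀ * (1 - θ * c)⁻¹) (B₃ * (1 - θ * c)⁻¹) B₃ c * Λ₁ ≤ K6 :=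
    (mul_le_mul hCle hΛ₁le hΛ₁0 hCsup0).trans hK6a
  have hKhle : Csup * Λh ≤ K6 := (mul_le_mul_of_nonneg_left hΛhle hCsup0).trans hK6a
  have hK4le : constG46 (constKp B₂ B₄ θ₂' c) c ≤ K6 := hKGle.trans hK6b
  have hK3le : NP * (constG46 (constKp B₂ B₄ θ₂' c) c * Λ₁) ≤ K6 :=
    (mul_le_mul_of_nonneg_left (mul_le_mul hKGle hΛ₁le hΛ₁0 hKGu0) hNP0).trans hK6c
  have hK5le : NP * (constG46 (constKp B₂ B₄ θ₂' c) c * Λm) ≤ K6 :=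
    (mul_le_mul_of_nonneg_left (mul_le_mul hKGle hΛmle hΛm0 hKGu0) hNP0).trans hK6c
  have hexp : ∀ {r₁ : ℝ}, δ ≤ r₁ → ∀ y y' : g.Site, Real.exp (-(r₁ * g.dist y y')) ≤ Real.exp (-(δ * g.dist y y')) :=
    fun h y y' => Real.exp_le_exp.mpr (neg_le_neg (mul_le_mul_of_nonneg_right h (hG.dnn y y')))
  have hP : ∀ t : ℝ, B9.pref6 t 0 = t ^ 2 ∧ B9.pref6 t 1 = t ∧ B9.pref6 t 2 = t ∧ B9.pref6 t 3 = 1 ∧ B9.pref6 t 4 = 1 ∧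
      B9.pref6 t 5 = 1 := fun t => by simp [B9.pref6]
  have hB0 : BlockBd (g := toB6 g R₀ H₀) 𝔬.blk 𝔬.blk (𝔬.GG U)
      (fun (y y' : g.Site) => K6 * B9.pref6 (g.len y) 0 * Real.exp (-(δ * g.dist y y'))) := by
    refine hb0.mono fun y y' => ?_
    rw [(hP (g.len y)).1]
    calc const313 (B₀ * (1 - θ * c)⁻¹) (B₃ * (1 - θ * c)⁻¹) B₃ c * Λ₁ * g.len y ^ 2 * Real.exp (-((1 - α) * ρ' * g.dist y y'))
        ≤ K6 * g.len y ^ 2 * Real.exp (-((1 - α) * ρ' * g.dist y y')) :=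
          mul_le_mul_of_nonneg_right (mul_le_mul_of_nonneg_right hK0le (sq_nonneg _)) (Real.exp_nonneg _)
      _ ≤ K6 * g.len y ^ 2 * Real.exp (-(δ * g.dist y y')) := mul_le_mul_of_nonneg_left (hexp hδ1 y y') (mul_nonneg hK60 (sq_nonneg _))
  have hB1 : BlockBd (g := toB6 g R₀ H₀) 𝔬.blk 𝔬.blkY (𝔬.D U ∘ₗ 𝔬.GG U)
      (fun (y y' : g.Site) => K6 * B9.pref6 (g.len y) 1 * Real.exp (-(δ * g.dist y y'))) := by
    refine hb1.mono fun y y' => ?_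
    rw [(hP (g.len y)).2.1]
    calc Csup * Λh * g.len y * Real.exp (-((1 - α) * ρ' * g.dist y y'))
        ≤ K6 * g.len y * Real.exp (-((1 - α) * ρ' * g.dist y y')) :=
          mul_le_mul_of_nonneg_right (mul_le_mul_of_nonneg_right hKhle (hlen y)) (Real.exp_nonneg _)
      _ ≤ K6 * g.len y * Real.exp (-(δ * g.dist y y')) := mul_le_mul_of_nonneg_left (hexp hδ1 y y') (mul_nonneg hK60 (hlen y))
  have hB2 : BlockBd (g := toB6 g R₀ H₀) 𝔬.blkY 𝔬.blk (𝔬.GG U ∘ₗ 𝔬.Dstar U)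
      (fun (y y' : g.Site) => K6 * B9.pref6 (g.len y) 2 * Real.exp (-(δ * g.dist y y'))) := by
    refine hb2.mono fun y y' => ?_
    rw [(hP (g.len y)).2.2.1]
    calc Csup * Λh * g.len y * Real.exp (-((1 - α) * ρ' * g.dist y y'))
        ≤ K6 * g.len y * Real.exp (-((1 - α) * ρ' * g.dist y y')) :=
          mul_le_mul_of_nonneg_right (mul_le_mul_of_nonneg_right hKhle (hlen y)) (Real.exp_nonneg _)
      _ ≤ K6 * g.len y * Real.exp (-(δ * g.dist y y')) := mul_le_mul_of_nonneg_left (hexp hδ1 y y') (mul_nonneg hK60 (hlen y))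
  have hB3 : BlockBd (g := toB6 g R₀ H₀) 𝔬.blk (𝔬.blk ∘ Prod.fst) (familyOp (fun q : P × P => (Dd U q.1 ∘ₗ Dd U q.2) ∘ₗ 𝔬.GG U))
      (fun (y y' : g.Site) => K6 * B9.pref6 (g.len y) 3 * Real.exp (-(δ * g.dist y y'))) := by
    refine hb3.mono fun y y' => ?_
    rw [(hP (g.len y)).2.2.2.1, mul_one]
    calc NP * (constG46 (constKp B₂ B₄ θ₂' c) c * Λ₁ * Real.exp (-((1 - α) * ρ' * g.dist y y')))
        = NP * (constG46 (constKp B₂ B₄ θ₂' c) c * Λ₁) * Real.exp (-((1 - α) * ρ' * g.dist y y')) := by ring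
      _ ≤ K6 * Real.exp (-(δ * g.dist y y')) := mul_le_mul hK3le (hexp hδ1 y y') (Real.exp_nonneg _) hK60
  have hB4 : BlockBd (g := toB6 g R₀ H₀) 𝔬.blkY 𝔬.blkY (𝔬.D U ∘ₗ (𝔬.GG U ∘ₗ 𝔬.Dstar U))
      (fun (y y' : g.Site) => K6 * B9.pref6 (g.len y) 4 * Real.exp (-(δ * g.dist y y'))) := by
    refine hb4.mono fun y y' => ?_
    rw [(hP (g.len y)).2.2.2.2.1, mul_one]
    exact mul_le_mul hK4le (hexp hδ2 y y') (Real.exp_nonneg _) hK60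
  have hB5 : BlockBd (g := toB6 g R₀ H₀) 𝔬.blk (𝔬.blk ∘ Prod.fst) (familyOp (fun q : P × P => 𝔬.GG U ∘ₗ (Dds U q.1 ∘ₗ Dds U q.2)))
      (fun (y y' : g.Site) => K6 * B9.pref6 (g.len y) 5 * Real.exp (-(δ * g.dist y y'))) := by
    refine hb5.mono fun y y' => ?_
    rw [(hP (g.len y)).2.2.2.2.2, mul_one]
    calc NP * (constG46 (constKp B₂ B₄ θ₂' c) c * Λm * Real.exp (-((1 - α) * ρ' * g.dist y y')))
        = NP * (constG46 (constKp B₂ B₄ θ₂' c) c * Λm) * Real.exp (-((1 - α) * ρ' * g.dist y y')) := by ring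
      _ ≤ K6 * Real.exp (-(δ * g.dist y y')) := mul_le_mul hK5le (hexp hδ1 y y') (Real.exp_nonneg _) hK60
  exact ⟨hB0, hB1, hB2, hB3, hB4, hB5⟩

/-- ★ **THEOREM 3.13 — THE L² BLOCK (3.46) OF A KERNEL FAMILY CO-READ ON THE NEIGHBOURHOOD BY THE MODELS OF 𝔊, RECORD INDEX ORDER** (the twin of
`…BlocksNbr.GG_l2Block_nbr` with the co-readings of n = 3 and n = 4 exchanged: `K.l2 3` read by the mixed ∇_U𝔊∇\*_U on the lattice Y, `K.l2 4` by the
pair family `familyOp (q ↦ ∇_{q.1}∇_{q.2}∘𝔊)` on X × (P × P) — the order of `Node00.kernelFamilyB.l2`), from `GG_blockBds_nbr` and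
`l2Block_of_blockBds_nbrRec`.  Conclusion: `L2Block K (mN·m·Cev·CL²·e^{rδ}·K₆) δ U`.  Nothing of print asserted.
[cite: Balaban1985BackgroundPropagators, Thm 3.13 p.426 + (3.152)–(3.153) p.426 + (3.46) p.398 + (3.39) p.397; Balaban1984PropagatorsII, (2.51)–(2.52) p.232 + Lemma 2.1 (2.60)–(2.61) p.234] -/
theorem GG_l2Block_nbrRec (hG : GeoOK g) {K : B9.KernelFamily g B} {𝔬 : Ops g B X Y Z W}
    {Dd Dds : B.Cfg → P → Module.End ℝ (X → ℝ)} {U : B.Cfg} {bH : BlockNorm (toB6 g R₀ H₀) (W → ℝ)}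
    (Rel : g.Site → g.Site → Prop) [DecidableRel Rel] (ev : g.Loc → X → ℝ) (evY : g.Loc → Y → ℝ) {m mN : ℕ}
    {r Cev CL θ θ' θ₂' B₀ B₂ B₃ B₄ δ₀ δ₃ δK ρ ρ' α σ c Csup KGu K6 Λ₁ Λh Λm Λu δ : ℝ}
    (hrow : RowSum (toB6 g R₀ H₀) σ c) (hc : 0 ≤ c) (hθ : 0 ≤ θ) (hθ' : 0 ≤ θ') (hθ₂' : 0 ≤ θ₂') (hB₀ : 0 ≤ B₀) (hB₂ : 0 ≤ B₂)
    (hB₃ : 0 ≤ B₃) (hB₄ : 0 ≤ B₄) (hσ : 0 ≤ σ) (hρ' : 0 < ρ') (hρ'ρ : ρ' + 3 * σ ≤ ρ) (hρ'ρ₅ : ρ' + 5 * σ ≤ ρ) (hρS : ρ ≤ δ₀)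
    (hρ₃ : ρ ≤ δ₃) (hρδ : ρ + σ ≤ δK) (hq1 : θ * c < 1) (hq₂1 : B₂ * θ₂' * c * c < 1) (hδ0 : 0 ≤ δ) (hδ1 : δ ≤ (1 - α) * ρ')
    (hδ2 : δ ≤ ρ')
    (hST1 : ScaleTransfer g ρ' α Λ₁ (fun y => g.len y ^ (1 : ℝ))) (hSTh : ScaleTransfer g ρ' α Λh (fun y => g.len y ^ (1 / 2 : ℝ)))
    (hSTm : ScaleTransfer g ρ' α Λm (fun y => g.len y ^ (-1 : ℝ))) (hΛ₁0 : 0 ≤ Λ₁) (hΛ₁le : Λ₁ ≤ Λu) (hΛhle : Λh ≤ Λu)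
    (hΛm0 : 0 ≤ Λm) (hΛmle : Λm ≤ Λu) (h1Λu : 1 ≤ Λu)
    (hCsup0 : 0 ≤ Csup) (hCle : const313 (B₀ * (1 - θ * c)⁻¹) (B₃ * (1 - θ * c)⁻¹) B₃ c ≤ Csup)
    (hDle : constD313 (B₀ + θ' * (B₀ * (1 - θ * c)⁻¹) * c) θ' (B₀ * (1 - θ * c)⁻¹) (B₃ * (1 - θ * c)⁻¹) B₃ bH.κ c ≤ Csup)
    (hKGu0 : 0 ≤ KGu) (hKGle : constG46 (constKp B₂ B₄ θ₂' c) c ≤ KGu) (hK60 : 0 ≤ K6) (hK6a : Csup * Λu ≤ K6) (hK6b : KGu ≤ K6)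
    (hK6c : Real.sqrt (Fintype.card (P × P)) * (KGu * Λu) ≤ K6)
    (hS1 : HasMaj (cNorm R₀ H₀ 𝔬.blk hG.lenle 1) (cNorm R₀ H₀ 𝔬.blk hG.lenle 1) (𝔬.G0 U ∘ₗ (𝔬.Tpi U + 𝔬.T2 U))
      (fun a b => θ * Real.exp (-(δK * g.dist a b))))
    (hS2 : HasMaj (cNorm R₀ H₀ 𝔬.blk hG.lenle 2) (cNorm R₀ H₀ 𝔬.blk hG.lenle 2) (𝔬.G0 U ∘ₗ (𝔬.Tpi U + 𝔬.T2 U))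
      (fun a b => θ * Real.exp (-(δK * g.dist a b))))
    (he0 : HasMajorant (g := toB6 g R₀ H₀) 𝔬.blk (𝔬.G0 U) (fun a b => B₀ * g.len a ^ 2 * Real.exp (-(δ₀ * g.dist a b))))
    (he2 : HasMajorantHom (g := toB6 g R₀ H₀) 𝔬.blkY 𝔬.blk (𝔬.G0 U ∘ₗ 𝔬.Dstar U)
      (fun a b => B₀ * g.len a * Real.exp (-(δ₀ * g.dist a b))))
    (hLS : LeftStep 𝔬 R₀ H₀ hG.lenle B₀ δ₀ θ' δK U)
    (hL : Letters313 𝔬 R₀ H₀ hG B₃ δ₃ U) (hLD : Letters313D 𝔬 R₀ H₀ hG B₃ δ₃ bH U) (hI : Identities 𝔬 U)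
    (hL2 : Thm33G0L2P 𝔬 Dd Dds R₀ H₀ B₂ ρ U)
    (hT : BlockBd (g := toB6 g R₀ H₀) 𝔬.blk 𝔬.blk (𝔬.Tpi U + 𝔬.T2 U)
      (fun (y y' : g.Site) => θ₂' * (g.len y)⁻¹ * (g.len y')⁻¹ * Real.exp (-(ρ * g.dist y y'))))
    (hLt : Letters313L2P 𝔬 Dd Dds R₀ H₀ B₄ ρ U)
    (hsym : IsTransposePair (𝔬.GG U) (𝔬.GG U)) (htr : IsTransposePair (𝔬.D U ∘ₗ 𝔬.GG U) (𝔬.GG U ∘ₗ 𝔬.Dstar U))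
    (hRd₂ : ∀ a b b', Rel b b' → g.dist a b = g.dist a b')
    (hmult : ∀ y' : g.Site, (Finset.univ.filter (fun y'' => Rel y'' y')).card ≤ m)
    (hnbr : ∀ y : g.Site, (nbr g r y).card ≤ mN)
    (hCL1 : 1 ≤ CL) (hCL : ∀ a a' : g.Site, g.dist a a' ≤ r → g.len a ≤ CL * g.len a') (hCev : 0 ≤ Cev)
    (hl0 : L2ReadsNbr (R := R₀) (H := H₀) K 0 U Rel r Cev 𝔬.blk 𝔬.blk ev (𝔬.GG U))
    (hl1 : L2ReadsNbr (R := R₀) (H := H₀) K 1 U Rel r Cev 𝔬.blkY 𝔬.blk ev (𝔬.D U ∘ₗ 𝔬.GG U))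
    (hl2 : L2ReadsNbr (R := R₀) (H := H₀) K 2 U Rel r Cev 𝔬.blk 𝔬.blkY evY (𝔬.GG U ∘ₗ 𝔬.Dstar U))
    (hl3 : L2ReadsNbr (R := R₀) (H := H₀) K 3 U Rel r Cev 𝔬.blkY 𝔬.blkY evY (𝔬.D U ∘ₗ (𝔬.GG U ∘ₗ 𝔬.Dstar U)))
    (hl4 : L2ReadsNbr (R := R₀) (H := H₀) K 4 U Rel r Cev (𝔬.blk ∘ Prod.fst) 𝔬.blk ev
      (familyOp (fun q : P × P => (Dd U q.1 ∘ₗ Dd U q.2) ∘ₗ 𝔬.GG U)))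
    (hl5 : L2ReadsNbr (R := R₀) (H := H₀) K 5 U Rel r Cev (𝔬.blk ∘ Prod.fst) 𝔬.blk ev
      (familyOp (fun q : P × P => 𝔬.GG U ∘ₗ (Dds U q.1 ∘ₗ Dds U q.2)))) :
    L2Block K (mN * m * Cev * CL ^ 2 * Real.exp (r * δ) * K6) δ U := by
  obtain ⟨hB0, hB1, hB2, hB3, hB4, hB5⟩ := GG_blockBds_nbr hG hrow hc hθ hθ' hθ₂' hB₀ hB₂ hB₃ hB₄ hσ hρ' hρ'ρ hρ'ρ₅ hρS hρ₃ hρδ hq1 hq₂1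
    hδ1 hδ2 hST1 hSTh hSTm hΛ₁0 hΛ₁le hΛhle hΛm0 hΛmle h1Λu hCsup0 hCle hDle hKGu0 hKGle hK60 hK6a hK6b hK6c hS1 hS2 he0 he2 hLS hL
    hLD hI hL2 hT hLt hsym htr
  exact l2Block_of_blockBds_nbrRec hG hRd₂ hmult hnbr hCL1 hCL hCev hK60 hδ0 hB0 hB1 hB2 hB3 hB4 hB5 hl0 hl1 hl2 hl3 hl4 hl5

end OneMember

end

end Literature.MathematicalPhysics.QuantumFieldTheory.Balaban1983to89.B9Thm313WholeBlocksNbrRec
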